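import Summits.KontsevichZagierPeriods.KontsevichZagierPeriods.Theses.DessinsDimensionOne
import Literature.NumberTheory.Transcendental.KZRelationsLE

/-!
# Line `merge_compress` — skeleton for the piece `OneAuxiliaryVariable` (stmt-KontsevichZagierPeriods-18966)
# of the BC2 split of `DessinsDimensionOne.ExcursionBudget` (stmt-KontsevichZagierPeriods-6259)

`OneAuxiliaryVariable` (conservativity defect one): `relations ⊓ formalRep_≤d ≤ relations_≤(d+1)` for
every `d` (the route decl inlines both truncations; `KZ.formalRepLE d` / `KZ.relationsLE (d + 1)` by
`rfl`). Line: MERGE, then COMPRESS A PAIR (the registered version of the strategist's birth skeleton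
`oneauxvar_merge_compress_birth`, now concluding the route decl by name).

* `stub_mergeLE` — budgeted merging: every formal combination supported in dimension `≤ d` is congruent
  modulo `relations_≤d` to a difference `[r] − [r']` of two representations of dimension exactly `d`
  (pad lower-dimensional generators up to dimension `d` by unit slabs — one Newton–Leibniz move each,
  inside dimension `≤ d` —, compress `ℝ^d` into the unit box by `xᵢ ↦ xᵢ/√(1+xᵢ²)` (rule 2), merge by
  disjoint translated unions (rules 2, 1a), collect signs; in dimension `0` merge by rule 1b). The
  budgeted form of the tree fact `KZ.exists_integralRep_sub`; provable now, size L.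
* `stub_pairCompression` — THE OPEN CONTENT, the pair form: two KZ-equivalent representations of the
  same dimension `d` are equivalent inside dimension `≤ d + 1` (`KZ.EquivalentLE (d + 1)`;
  = `DimensionBudget.DimOneWithinTwo` in every dimension).
* `OneAuxiliaryVariable_of` — real proof: `c ≡ [r] − [r'] (mod relations_≤d)`, so `[r] − [r'] ∈
  relations`; compress the pair into `relations_≤(d+1)` and add back the `relations_≤d`-congruence
  (`KZ.relationsLE_mono`). Conclusion: literally the route decl
  `Summit.KontsevichZagierPeriods.KontsevichZagierPeriods.Theses.DessinsDimensionOne.OneAuxiliaryVariable`.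

Sources: KontsevichZagier2001 §1.2 Problem 2; Ayoub2015 Rem. 1.2/1.5; Wan2011; CressonViusos2022.
-/

namespace Summit.KontsevichZagierPeriods.KontsevichZagierPeriods.Cruxes.OneAuxiliaryVariable.MergeCompress

open Literature.NumberTheory.Transcendental
open Summit.KontsevichZagierPeriods.KontsevichZagierPeriods.Theses.DessinsDimensionOne (OneAuxiliaryVariable)

/-- STUB 1 (budgeted merging, provable now, L): a formal combination supported in dimension `≤ d` is,
modulo the relations truncated at `d`, a difference of two representations of dimension `d`. -/
theorem stub_mergeLE : ∀ (d : ℕ) (c : KZ.FormalRep), c ∈ KZ.formalRepLE d →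
    ∃ (r r' : KZ.IntegralRep d), c - (KZ.of r - KZ.of r') ∈ KZ.relationsLE d := by
  sorry

/-- STUB 2 (pair compression, THE OPEN CONTENT): two KZ-equivalent representations of the same
dimension `d` are equivalent inside dimension `≤ d + 1`. -/
theorem stub_pairCompression : ∀ (d : ℕ) (r r' : KZ.IntegralRep d),
    KZ.Equivalent r r' → KZ.EquivalentLE (d + 1) r r' := by
  sorry

/-- COMPOSITION (real proof, concluding the route decl BY NAME): merging + pair compression give
conservativity defect one. -/
theorem OneAuxiliaryVariable_of
    (h1 : ∀ (d : ℕ) (c : KZ.FormalRep), c ∈ KZ.formalRepLE d →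
      ∃ (r r' : KZ.IntegralRep d), c - (KZ.of r - KZ.of r') ∈ KZ.relationsLE d)
    (h2 : ∀ (d : ℕ) (r r' : KZ.IntegralRep d), KZ.Equivalent r r' → KZ.EquivalentLE (d + 1) r r') :
    OneAuxiliaryVariable := by
  intro d c hc hcd
  -- the inlined closures of the route decl are `KZ.formalRepLE d` and `KZ.relationsLE (d + 1)` by `rfl`
  change c ∈ KZ.formalRepLE d at hcd
  change c ∈ KZ.relationsLE (d + 1)
  obtain ⟨r, r', h⟩ := h1 d c hcd
  have hsub : c - (KZ.of r - KZ.of r') ∈ KZ.relations := KZ.relationsLE_le_relations d h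
  have hrr' : KZ.of r - KZ.of r' ∈ KZ.relations := by
    have e : KZ.of r - KZ.of r' = c - (c - (KZ.of r - KZ.of r')) := by abel
    rw [e]
    exact sub_mem hc hsub
  have hpair : KZ.of r - KZ.of r' ∈ KZ.relationsLE (d + 1) := h2 d r r' hrr'
  have e : c = (c - (KZ.of r - KZ.of r')) + (KZ.of r - KZ.of r') := by abel
  rw [e]
  exact add_mem (KZ.relationsLE_mono (Nat.le_succ d) h) hpair

/-- The skeleton closes the piece from its two stubs. -/
theorem OneAuxiliaryVariable_holds_of_stubs : OneAuxiliaryVariable :=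
  OneAuxiliaryVariable_of stub_mergeLE stub_pairCompression

end Summit.KontsevichZagierPeriods.KontsevichZagierPeriods.Cruxes.OneAuxiliaryVariable.MergeCompress
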